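import Summits.KontsevichZagierPeriods.KontsevichZagierPeriods.Theorems.RootDecompRationalCubeDichotomySimpleBranchInnerResidue
import Literature.NumberTheory.Transcendental.KZSemiCanonicalReductionProofs
import Literature.NumberTheory.Transcendental.KZIntervalPeriodProofs
import Literature.NumberTheory.Transcendental.KZTameMoveFamily
import Literature.NumberTheory.Transcendental.KZSemialgebraicComplex
import Literature.NumberTheory.Transcendental.SemialgebraicMapsProofs
import Mathlib

/-!
# Route RootDecompRationalCubeDichotomy — items 29429 `PiRationalisationEtale` / 29431 `PiRationalisationGlue` PROVED, part 1/8: the WEIGHTED residue form (ReIm part 5e — `A·F_w/(B·F) − (A/B)(x,y)/(w−y)` is regular at the simple root: `exists_residueFormE`, `residue_identityE`, `pole_reE`, `pole_imE`, `ratRe_ratIm_eqE`) (`RootDecompRationalCubeDichotomyEtaleResidueForm`)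

Theorems-split (≤ 400 lines each, sequential imports) of the decomp-kz lens-2 gen-5 file
`run/shared/lean/pub/decomp-kz/decomp-kz-lens-2/g5/PiRationalisationEtale.lean` (sha256 204f4992…, 2557 lines; lens farm rc 0 / 0 sorry /
std axioms; critic decomp-kz-crit-1 g2 CLEARED/CONFIRMED 2026-08-30T06:50:50Z «29429 + 29431 proved BY NAME»), landed by the census seat
decomp-kz-census-1 g6 with the 86 verbatim copies of already-landed declarations REMOVED in favour of `import`/`open` of the landed
`Rung27842.ReIm` / `Rung27842.SimpleBranch` / `Rung24903` chain (`ratCubeSet`, `piIter_mem_sup`, `RatBoxSet`, `BoxRescale`, `boxRescale_holds`,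
the Re–Im polynomial calculus, the Green assembly kit, the S3/S1 lemmas), so that only the NEW weighted (étale) content is declared here.
The rung: for WEIGHTED simple-branch (standard-étale) data `[Π[loᵢ,hiᵢ], A(x,h x)/B(x,h x)]` (`F(x,h) = 0`, `∂_w F(x,h) ≠ 0`, `B(x,h) ≠ 0` on the
closed box, `F A B ∈ ℚ[x,w]`, `h` ℚ-Nash near the box) `[π]^K·[s] ∈ relations ⊔ ⟨rational closed-cube sector⟩` for every `K ≥ 1` — the gen-4
argument-principle chain with the contour form `ω = A·F_w/(B·F) dw`, whose residue at the simple real root is `A/B = s.integrand`.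
[Kontsevich–Zagier 2001 §1.2; argument principle] Standard axioms, 0 sorry.
-/

noncomputable section

set_option linter.dupNamespace false

namespace Summit.KontsevichZagierPeriods.RootDecompRationalCubeDichotomy.RungEtale.ReIm

open MvPolynomial
open Summit.KontsevichZagierPeriods.RootDecompRationalCubeDichotomy.Rung27842
open Summit.KontsevichZagierPeriods.RootDecompRationalCubeDichotomy.Rung27842.ReIm

variable {n : ℕ}

/-- **Weighted residue form (pure algebra).** -/
theorem exists_residueFormE (F A B : MvPolynomial (Fin (n + 1)) ℚ) :
    ∃ Nr Dr Q : MvPolynomial (Fin (n + 2)) ℚ,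
      (∀ {R : Type} [CommRing R] [Algebra ℚ R] (x : Fin n → R) (y w : R),
        aeval (Fin.snoc x w : Fin (n + 1) → R) F - aeval (Fin.snoc x y : Fin (n + 1) → R) F =
          (w - y) * aeval (Fin.snoc (Fin.snoc x y : Fin (n + 1) → R) w : Fin (n + 2) → R) Q) ∧
      (∀ {R : Type} [CommRing R] [Algebra ℚ R] (x : Fin n → R) (y : R),
        aeval (Fin.snoc (Fin.snoc x y : Fin (n + 1) → R) y : Fin (n + 2) → R) Q =
          aeval (Fin.snoc x y : Fin (n + 1) → R) (pderiv (Fin.last n) F)) ∧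
      (∀ {R : Type} [CommRing R] [Algebra ℚ R] (x : Fin n → R) (y w : R),
        aeval (Fin.snoc x w : Fin (n + 1) → R) A * aeval (Fin.snoc x w : Fin (n + 1) → R) (pderiv (Fin.last n) F) *
              aeval (Fin.snoc x y : Fin (n + 1) → R) B -
            aeval (Fin.snoc x y : Fin (n + 1) → R) A * aeval (Fin.snoc x w : Fin (n + 1) → R) B *
              aeval (Fin.snoc (Fin.snoc x y : Fin (n + 1) → R) w : Fin (n + 2) → R) Q =
          (w - y) * aeval (Fin.snoc (Fin.snoc x y : Fin (n + 1) → R) w : Fin (n + 2) → R) Nr) ∧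
      (∀ {R : Type} [CommRing R] [Algebra ℚ R] (x : Fin n → R) (y w : R),
        aeval (Fin.snoc (Fin.snoc x y : Fin (n + 1) → R) w : Fin (n + 2) → R) Dr =
          aeval (Fin.snoc x y : Fin (n + 1) → R) B * aeval (Fin.snoc x w : Fin (n + 1) → R) B *
            aeval (Fin.snoc (Fin.snoc x y : Fin (n + 1) → R) w : Fin (n + 2) → R) Q) := by
  obtain ⟨Q, h1, h2⟩ := RootIso.exists_divDiff F
  set G : MvPolynomial (Fin (n + 2)) ℚ :=
    rename (skipY n) (A * pderiv (Fin.last n) F) * rename Fin.castSucc B -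
      rename Fin.castSucc A * rename (skipY n) B * Q with hG
  obtain ⟨K', hK1, -⟩ := RootIso.exists_divDiff (n := n + 1) G
  refine ⟨rename (collapseY n) K', rename Fin.castSucc B * rename (skipY n) B * Q, Q, h1, h2,
    fun x y w => ?_, fun x y w => ?_⟩
  · have hGw : aeval (Fin.snoc (Fin.snoc x y : Fin (n + 1) → _) w : Fin (n + 2) → _) G =
        aeval (Fin.snoc x w : Fin (n + 1) → _) A * aeval (Fin.snoc x w : Fin (n + 1) → _) (pderiv (Fin.last n) F) *
            aeval (Fin.snoc x y : Fin (n + 1) → _) B -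
          aeval (Fin.snoc x y : Fin (n + 1) → _) A * aeval (Fin.snoc x w : Fin (n + 1) → _) B *
            aeval (Fin.snoc (Fin.snoc x y : Fin (n + 1) → _) w : Fin (n + 2) → _) Q := by
      simp only [hG, map_sub, map_mul, aeval_rename, snoc_snoc_comp_skipY, Fin.snoc_comp_castSucc]
    have hGy : aeval (Fin.snoc (Fin.snoc x y : Fin (n + 1) → _) y : Fin (n + 2) → _) G = 0 := by
      simp only [hG, map_sub, map_mul, aeval_rename, snoc_snoc_comp_skipY, Fin.snoc_comp_castSucc, h2]
      ring
    have := hK1 (Fin.snoc x y) y w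
    rw [hGy, sub_zero, hGw] at this
    rw [this, aeval_rename, snoc_snoc_comp_collapseY]
  · simp only [map_mul, aeval_rename, snoc_snoc_comp_skipY, Fin.snoc_comp_castSucc]

/-- **The weighted residue identity over `ℂ`.** At a real root `y` of `F(x,·)` with `B(x,y) ≠ 0`, `c·B(x,y) = A(x,y)`,
and a point `z ≠ y` with `F(x,z) ≠ 0`, `B(x,z) ≠ 0`: `Dr(x,y,z) ≠ 0` and
`A F_w/(B F)(x,z) − c/(z−y) = Nr(x,y,z)/Dr(x,y,z)`. -/
theorem residue_identityE {F A B : MvPolynomial (Fin (n + 1)) ℚ} {Nr Dr Q : MvPolynomial (Fin (n + 2)) ℚ}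
    (h1 : ∀ {R : Type} [CommRing R] [Algebra ℚ R] (x : Fin n → R) (y w : R),
        aeval (Fin.snoc x w : Fin (n + 1) → R) F - aeval (Fin.snoc x y : Fin (n + 1) → R) F =
          (w - y) * aeval (Fin.snoc (Fin.snoc x y : Fin (n + 1) → R) w : Fin (n + 2) → R) Q)
    (h3 : ∀ {R : Type} [CommRing R] [Algebra ℚ R] (x : Fin n → R) (y w : R),
        aeval (Fin.snoc x w : Fin (n + 1) → R) A * aeval (Fin.snoc x w : Fin (n + 1) → R) (pderiv (Fin.last n) F) *
              aeval (Fin.snoc x y : Fin (n + 1) → R) B -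
            aeval (Fin.snoc x y : Fin (n + 1) → R) A * aeval (Fin.snoc x w : Fin (n + 1) → R) B *
              aeval (Fin.snoc (Fin.snoc x y : Fin (n + 1) → R) w : Fin (n + 2) → R) Q =
          (w - y) * aeval (Fin.snoc (Fin.snoc x y : Fin (n + 1) → R) w : Fin (n + 2) → R) Nr)
    (h4 : ∀ {R : Type} [CommRing R] [Algebra ℚ R] (x : Fin n → R) (y w : R),
        aeval (Fin.snoc (Fin.snoc x y : Fin (n + 1) → R) w : Fin (n + 2) → R) Dr =
          aeval (Fin.snoc x y : Fin (n + 1) → R) B * aeval (Fin.snoc x w : Fin (n + 1) → R) B *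
            aeval (Fin.snoc (Fin.snoc x y : Fin (n + 1) → R) w : Fin (n + 2) → R) Q)
    (x : Fin n → ℝ) (y c : ℝ) (z : ℂ)
    (hF0 : aeval (Fin.snoc x y : Fin (n + 1) → ℝ) F = 0)
    (hBy : aeval (Fin.snoc x y : Fin (n + 1) → ℝ) B ≠ 0)
    (hc : c * aeval (Fin.snoc x y : Fin (n + 1) → ℝ) B = aeval (Fin.snoc x y : Fin (n + 1) → ℝ) A)
    (hz : z ≠ (y : ℂ))
    (hFz : aeval (RootIso.cpt x z) F ≠ 0) (hBz : aeval (RootIso.cpt x z) B ≠ 0) :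
    aeval (Fin.snoc (RootIso.cpt x (y : ℂ)) z : Fin (n + 2) → ℂ) Dr ≠ 0 ∧
      aeval (RootIso.cpt x z) A * aeval (RootIso.cpt x z) (pderiv (Fin.last n) F) /
            (aeval (RootIso.cpt x z) B * aeval (RootIso.cpt x z) F) - (c : ℂ) / (z - y) =
        aeval (Fin.snoc (RootIso.cpt x (y : ℂ)) z : Fin (n + 2) → ℂ) Nr /
          aeval (Fin.snoc (RootIso.cpt x (y : ℂ)) z : Fin (n + 2) → ℂ) Dr := by
  have hF0' : aeval (RootIso.cpt x (y : ℂ)) F = 0 := by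
    rw [RootIso.cpt_ofReal, RootIso.aeval_ofReal_comp, hF0, Complex.ofReal_zero]
  have hBy' : aeval (RootIso.cpt x (y : ℂ)) B ≠ 0 := by
    rw [RootIso.cpt_ofReal, RootIso.aeval_ofReal_comp, Complex.ofReal_ne_zero]; exact hBy
  have hc' : (c : ℂ) * aeval (RootIso.cpt x (y : ℂ)) B = aeval (RootIso.cpt x (y : ℂ)) A := by
    rw [RootIso.cpt_ofReal, RootIso.aeval_ofReal_comp, RootIso.aeval_ofReal_comp, ← Complex.ofReal_mul, hc]
  have e1 : aeval (RootIso.cpt x z) F =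
      (z - y) * aeval (Fin.snoc (RootIso.cpt x (y : ℂ)) z : Fin (n + 2) → ℂ) Q := by
    have := h1 (fun i => ((x i : ℝ) : ℂ)) (y : ℂ) z
    simp only [RootIso.cpt] at hF0' ⊢
    rw [hF0', sub_zero] at this
    exact this
  have e3 := h3 (fun i => ((x i : ℝ) : ℂ)) (y : ℂ) z
  have e4 := h4 (fun i => ((x i : ℝ) : ℂ)) (y : ℂ) z
  simp only [RootIso.cpt] at e1 e3 e4 hFz hBz hBy' hc' ⊢
  have hzy : z - (y : ℂ) ≠ 0 := sub_ne_zero.2 hz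
  have hQ : aeval (Fin.snoc (Fin.snoc (fun i => ((x i : ℝ) : ℂ)) (y : ℂ) : Fin (n + 1) → ℂ) z : Fin (n + 2) → ℂ) Q ≠ 0 := by
    intro h; apply hFz; rw [e1, h, mul_zero]
  have hD : aeval (Fin.snoc (Fin.snoc (fun i => ((x i : ℝ) : ℂ)) (y : ℂ) : Fin (n + 1) → ℂ) z : Fin (n + 2) → ℂ) Dr ≠ 0 := by
    rw [e4]; exact mul_ne_zero (mul_ne_zero hBy' hBz) hQ
  refine ⟨hD, ?_⟩
  rw [div_sub_div _ _ (mul_ne_zero hBz hFz) hzy, div_eq_div_iff (mul_ne_zero (mul_ne_zero hBz hFz) hzy) hD, e1, e4]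
  linear_combination
    ((z - (y : ℂ)) * aeval (Fin.snoc (fun i => ((x i : ℝ) : ℂ)) z : Fin (n + 1) → ℂ) B *
        aeval (Fin.snoc (Fin.snoc (fun i => ((x i : ℝ) : ℂ)) (y : ℂ) : Fin (n + 1) → ℂ) z : Fin (n + 2) → ℂ) Q) * e3 -
      ((z - (y : ℂ)) * aeval (Fin.snoc (fun i => ((x i : ℝ) : ℂ)) z : Fin (n + 1) → ℂ) B *
          aeval (Fin.snoc (Fin.snoc (fun i => ((x i : ℝ) : ℂ)) (y : ℂ) : Fin (n + 1) → ℂ) z : Fin (n + 2) → ℂ) Q *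
          aeval (Fin.snoc (fun i => ((x i : ℝ) : ℂ)) z : Fin (n + 1) → ℂ) B *
          aeval (Fin.snoc (Fin.snoc (fun i => ((x i : ℝ) : ℂ)) (y : ℂ) : Fin (n + 1) → ℂ) z : Fin (n + 2) → ℂ) Q) * hc'

/-- Real part of the weighted pole term `c/(s + iv − y)`. -/
theorem pole_reE (c y s v : ℝ) (h : (s - y) ^ 2 + v ^ 2 ≠ 0) :
    ((c : ℂ) / (((s : ℂ) + (v : ℂ) * Complex.I) - y)).re = c * (s - y) / ((s - y) ^ 2 + v ^ 2) := by
  have hz : ((s : ℂ) + (v : ℂ) * Complex.I) - y = ⟨s - y, v⟩ := by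
    apply Complex.ext <;> simp
  rw [hz, Complex.div_re, Complex.normSq_mk]
  simp only [Complex.ofReal_re, Complex.ofReal_im]
  field_simp
  ring

/-- Imaginary part of the weighted pole term `c/(s + iv − y)`. -/
theorem pole_imE (c y s v : ℝ) (h : (s - y) ^ 2 + v ^ 2 ≠ 0) :
    ((c : ℂ) / (((s : ℂ) + (v : ℂ) * Complex.I) - y)).im = -(c * v) / ((s - y) ^ 2 + v ^ 2) := by
  have hz : ((s : ℂ) + (v : ℂ) * Complex.I) - y = ⟨s - y, v⟩ := by
    apply Complex.ext <;> simp
  rw [hz, Complex.div_im, Complex.normSq_mk]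
  simp only [Complex.ofReal_re, Complex.ofReal_im]
  field_simp
  ring

/-- **`Re ω = Re(pole) + Re r` and `Im ω = Im(pole) + Im r` on the punctured isolation region**, `ω = A F_w/(B F)`,
pole coefficient `c = A(x,y)/B(x,y)`, `r = Nr/Dr` at the graph point `(x, y, s, v)`. -/
theorem ratRe_ratIm_eqE {F A B : MvPolynomial (Fin (n + 1)) ℚ} {Nr Dr Q : MvPolynomial (Fin (n + 2)) ℚ}
    (h1 : ∀ {R : Type} [CommRing R] [Algebra ℚ R] (x : Fin n → R) (y w : R),
        aeval (Fin.snoc x w : Fin (n + 1) → R) F - aeval (Fin.snoc x y : Fin (n + 1) → R) F =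
          (w - y) * aeval (Fin.snoc (Fin.snoc x y : Fin (n + 1) → R) w : Fin (n + 2) → R) Q)
    (h3 : ∀ {R : Type} [CommRing R] [Algebra ℚ R] (x : Fin n → R) (y w : R),
        aeval (Fin.snoc x w : Fin (n + 1) → R) A * aeval (Fin.snoc x w : Fin (n + 1) → R) (pderiv (Fin.last n) F) *
              aeval (Fin.snoc x y : Fin (n + 1) → R) B -
            aeval (Fin.snoc x y : Fin (n + 1) → R) A * aeval (Fin.snoc x w : Fin (n + 1) → R) B *
              aeval (Fin.snoc (Fin.snoc x y : Fin (n + 1) → R) w : Fin (n + 2) → R) Q =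
          (w - y) * aeval (Fin.snoc (Fin.snoc x y : Fin (n + 1) → R) w : Fin (n + 2) → R) Nr)
    (h4 : ∀ {R : Type} [CommRing R] [Algebra ℚ R] (x : Fin n → R) (y w : R),
        aeval (Fin.snoc (Fin.snoc x y : Fin (n + 1) → R) w : Fin (n + 2) → R) Dr =
          aeval (Fin.snoc x y : Fin (n + 1) → R) B * aeval (Fin.snoc x w : Fin (n + 1) → R) B *
            aeval (Fin.snoc (Fin.snoc x y : Fin (n + 1) → R) w : Fin (n + 2) → R) Q)
    (x : Fin n → ℝ) (y c s v : ℝ)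
    (hF0 : aeval (Fin.snoc x y : Fin (n + 1) → ℝ) F = 0)
    (hBy : aeval (Fin.snoc x y : Fin (n + 1) → ℝ) B ≠ 0)
    (hc : c * aeval (Fin.snoc x y : Fin (n + 1) → ℝ) B = aeval (Fin.snoc x y : Fin (n + 1) → ℝ) A)
    (hsv : ¬ (s = y ∧ v = 0))
    (hDz : aeval (cplxPoint (Fin.snoc (Fin.snoc x s : Fin (n + 1) → ℝ) v)) (B * F) ≠ 0) :
    aeval (cplxPoint (Fin.snoc (Fin.snoc (Fin.snoc x y : Fin (n + 1) → ℝ) s : Fin (n + 2) → ℝ) v)) Dr ≠ 0 ∧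
    ratRe (A * pderiv (Fin.last n) F) (B * F) (Fin.snoc (Fin.snoc x s : Fin (n + 1) → ℝ) v) =
        c * (s - y) / ((s - y) ^ 2 + v ^ 2) +
          ratRe Nr Dr (Fin.snoc (Fin.snoc (Fin.snoc x y : Fin (n + 1) → ℝ) s : Fin (n + 2) → ℝ) v) ∧
      ratIm (A * pderiv (Fin.last n) F) (B * F) (Fin.snoc (Fin.snoc x s : Fin (n + 1) → ℝ) v) =
        -(c * v) / ((s - y) ^ 2 + v ^ 2) +
          ratIm Nr Dr (Fin.snoc (Fin.snoc (Fin.snoc x y : Fin (n + 1) → ℝ) s : Fin (n + 2) → ℝ) v) := by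
  set z : ℂ := (s : ℂ) + (v : ℂ) * Complex.I with hzdef
  have hz : z ≠ (y : ℂ) := by
    intro h
    apply hsv
    have hre := congrArg Complex.re h
    have him := congrArg Complex.im h
    simp [hzdef] at hre him
    exact ⟨hre, him⟩
  have hDz' : aeval (RootIso.cpt x z) (B * F) ≠ 0 := by rwa [cplxPoint_snoc_snoc_eq_cpt] at hDz
  rw [map_mul] at hDz'
  have hBz' : aeval (RootIso.cpt x z) B ≠ 0 := left_ne_zero_of_mul hDz'
  have hFz' : aeval (RootIso.cpt x z) F ≠ 0 := right_ne_zero_of_mul hDz'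
  obtain ⟨hD, hid⟩ := residue_identityE h1 h3 h4 x y c z hF0 hBy hc hz hFz' hBz'
  have hpt : cplxPoint (Fin.snoc (Fin.snoc (Fin.snoc x y : Fin (n + 1) → ℝ) s : Fin (n + 2) → ℝ) v) =
      (Fin.snoc (RootIso.cpt x (y : ℂ)) z : Fin (n + 2) → ℂ) := by
    rw [cplxPoint_snoc_snoc_eq_cpt, RootIso.cpt_ofReal]; rfl
  have hsq : (s - y) ^ 2 + v ^ 2 ≠ 0 := by
    intro h0
    apply hsv
    have h1' : (s - y) ^ 2 = 0 := by nlinarith [sq_nonneg (s - y), sq_nonneg v]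
    have h2' : v ^ 2 = 0 := by nlinarith [sq_nonneg (s - y), sq_nonneg v]
    exact ⟨by simpa [sub_eq_zero] using pow_eq_zero_iff (n := 2) (by norm_num) |>.1 h1',
      pow_eq_zero_iff (n := 2) (by norm_num) |>.1 h2'⟩
  have hh : aeval (cplxPoint (Fin.snoc (Fin.snoc x s : Fin (n + 1) → ℝ) v)) (A * pderiv (Fin.last n) F) /
      aeval (cplxPoint (Fin.snoc (Fin.snoc x s : Fin (n + 1) → ℝ) v)) (B * F) =
      (c : ℂ) / (z - y) + aeval (Fin.snoc (RootIso.cpt x (y : ℂ)) z : Fin (n + 2) → ℂ) Nr /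
          aeval (Fin.snoc (RootIso.cpt x (y : ℂ)) z : Fin (n + 2) → ℂ) Dr := by
    rw [← hid, cplxPoint_snoc_snoc_eq_cpt]
    simp only [map_mul]
    ring
  refine ⟨by rw [hpt]; exact hD, ?_, ?_⟩
  · simp only [ratRe]
    rw [hh, hpt, Complex.add_re, pole_reE c y s v hsq]
  · simp only [ratIm]
    rw [hh, hpt, Complex.add_im, pole_imE c y s v hsq]

end Summit.KontsevichZagierPeriods.RootDecompRationalCubeDichotomy.RungEtale.ReIm
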